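import Summits.ResolutionOfSingularities.ResolutionOfSingularities.Theorems.MarkedTransferCampaignW46LooseExitTree
import HarnessLib

/-!
# [OURS · L1 W4.6 rung (i-b)] The loose exit tree is finitely branching (the chart lemma with decoupled exponents)
# (cell res-hironaka, LADDER-RESOLUTION rung L, D-0089; campaign s46, prover res-L1-s46-pv-1; host route MarkedTransfer,
# `--supports stmt-ResolutionOfSingularities-16155`)

HONEST FRAMING. Nothing here is a statement of H. Hironaka's manuscript (2017-03-23, [Hironaka2017]); pure commutative
algebra inside a field `K`, continuing `MarkedTransferCampaignW46LooseExitTree.lean` in the currency of res-L1-s46-pv-8's marked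
quadratic tree. AI-written; weaker than expert review. No `sorry`; axioms standard.

Let `(S, 𝔪 = (x, y))` be a two-dimensional regular local ring of `K`, `J ⊆ S` of exact order `r`, and `m ≤ r < m + b`. At a
two-dimensional first quadratic transform `S' ⊇ A = S[y/x]`, `(J S' : x^m) = x^{r-m} · W S'` with `W = (JA : x^r)` the weak
transform; if it has order `≥ b` at `S'` then `W ⊆ Q` (else `x^{r-m} ∈ 𝔪_{S'}^b` with `r - m < b`), so `S'` is the local ring at
a minimal prime over `W + xA` — finitely many. This is res-L1-s46-pv-8's `exists_minimalPrime_of_ctrlTransform_le` /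
`finite_setOf_isQuadraticTransform_ctrlTransform_le` (p501084, the tame case `m = b`) with the colon exponent `m` and the test
exponent `b` DECOUPLED; applied with the loose exponent `m = b·⌊r/b⌋` it gives the finite branching of the loose exit tree.

## Contents

* `exists_minimalPrime_of_ctrlTransform_le₂`, `finite_setOf_isQuadraticTransform_ctrlTransform_le₂`.
* **`finite_setOf_looseStep_isSingularNode`** — an isolated node has finitely many singular loose children.

## References

* O. Zariski, P. Samuel, *Commutative Algebra* II (1960), Appendix 5. [ZariskiSamuel1960]
* C. Huneke, I. Swanson, *Integral Closure of Ideals, Rings, and Modules* (2006), §14.2 (p. 264), Lemma 14.3.4.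
  [HunekeSwanson2006]
-/

noncomputable section

open IsLocalRing

-- single-problem summit: the doubled namespace component `ResolutionOfSingularities` is forced
set_option linter.dupNamespace false

namespace Summit.ResolutionOfSingularities.ResolutionOfSingularities.Theorems.CampaignW46

open Literature.AlgebraicGeometry.Resolution

universe u

variable {K : Type u} [Field K]

/-! ## Finite branching: the chart lemma with decoupled exponents -/

section Chart

variable {S : Subring K} [IsRegularLocalRing S] {x y : S} {b m : ℕ}

/-- **A singular child in the chart of `x` lies over a minimal prime of `W + xA`** — the chart lemma of the marked
tree (`exists_minimalPrime_of_ctrlTransform_le`) with the colon exponent `m` and the test exponent `b` decoupled: for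
`J` of exact order `r` with `m ≤ r < m + b` and a two-dimensional regular first quadratic transform `S' ⊇ S[y/x]` at
which `(J S' : x^m)` has order `≥ b`, `S'` is the local ring of `A = S[y/x]` at a minimal prime over `(JA : x^r) + xA`
(if `W ⊄ Q` then `x^{r-m} ∈ 𝔪_{S'}^b` with `r - m < b`, impossible since `x ∉ 𝔪_{S'}^2`).
[cite: ZariskiSamuel1960, Appendix 5] -/
theorem exists_minimalPrime_of_ctrlTransform_le₂ (hdim : ringKrullDim S = 2)
    (hm : maximalIdeal S = Ideal.span {x, y}) (hx0 : x ≠ 0) (hpq : ∀ t, x ∣ y * t → x ∣ t)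
    {J : Ideal S} {r : ℕ} (hJ : J ≤ maximalIdeal S ^ r) (hJr : ¬ J ≤ maximalIdeal S ^ (r + 1))
    (hbr : m ≤ r) (hr2 : r < m + b)
    {S' : Subring K} [IsRegularLocalRing S'] (h₁ : IsQuadraticTransform S S')
    (hd' : ringKrullDim S' = 2) (hle : chartAdjoin (K := K) x y ≤ S')
    (hsing : ctrlTransform m S J S' ≤ maximalIdeal S' ^ b) :
    ∃ Q ∈ (weakTransformChart (K := K) x y J r ⊔ Ideal.span {chartIncl x y x}).minimalPrimes,
      ∃ _ : Q.IsPrime, S' = (LocalSubring.ofPrime (chartAdjoin (K := K) x y) Q).toSubring := by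
  have hxm : x ∈ maximalIdeal S := hm ▸ Ideal.subset_span (by simp)
  have hym : y ∈ maximalIdeal S := hm ▸ Ideal.subset_span (by simp)
  set A := chartAdjoin (K := K) x y with hAdef
  set Q : Ideal A := (maximalIdeal S').comap (Subring.inclusion hle) with hQdef
  have hA : blowupRing S (x : K) = A := blowupRing_eq_adjoin hm
  have hR₁ : S' = (LocalSubring.ofPrime A Q).toSubring := h₁.eq_ofPrime_of_le hxm hx0 hA.le hle
  -- the exceptional prime `𝔭 = xA ≤ Q`
  haveI h𝔭 : (Ideal.span {chartIncl (K := K) x y x}).IsPrime := by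
    rw [← map_maximalIdeal_chartIncl hm hx0]
    exact isPrime_map_incl (K := K) hx0 hpq hxm hym
  have h𝔭Q : Ideal.span {chartIncl (K := K) x y x} ≤ Q := by
    rw [Ideal.span_singleton_le_iff_mem, hQdef, Ideal.mem_comap]
    exact (incl_mem_maximalIdeal_iff h₁.dominates x).mpr hxm
  -- `W ≤ Q`: else `x^{r-m} ∈ 𝔪_{S'}^b`
  set W := weakTransformChart (K := K) x y J r with hWdef
  have hWQ : W ≤ Q := by
    by_contra hnot
    obtain ⟨w, hwW, hwQ⟩ := Set.not_subset.mp hnot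
    have htop : W.map (Subring.inclusion hle) = ⊤ := by
      refine Ideal.eq_top_of_isUnit_mem _ (Ideal.mem_map_of_mem _ hwW) ?_
      have hw' : Subring.inclusion hle w ∉ maximalIdeal S' := fun h => hwQ (Ideal.mem_comap.mpr h)
      exact IsLocalRing.notMem_maximalIdeal.mp hw'
    have hmem : Subring.inclusion hle (chartIncl x y x) ^ (r - m) ∈ maximalIdeal S' ^ b :=
      hsing (pow_mem_ctrlTransform_of_map_eq_top hm hx0 hJ hbr hle htop)
    -- `x ∉ 𝔪_{S'}^2`
    obtain ⟨f, hm'⟩ := exists_maximalIdeal_eq_span_pair_of_isQuadraticTransform hm hx0 h₁ hle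
    have hx2 : Subring.inclusion hle (chartIncl x y x) ∉ maximalIdeal S' ^ 2 := fst_not_mem_sq hd' hm'
    have hpow := pow_not_mem_pow_of_not_mem_pow (p := 1) hx2 (r - m)
    rw [mul_one] at hpow
    exact hpow (Ideal.pow_le_pow_right (by omega) hmem)
  -- `Q` is minimal over `W + xA`
  have hWx : ¬ W ≤ Ideal.span {chartIncl (K := K) x y x} :=
    weakTransform_not_le_span hdim hm hx0 hJ hJr
  refine ⟨Q, ⟨⟨inferInstance, sup_le hWQ h𝔭Q⟩, fun P ⟨hP, hIP⟩ hPQ => ?_⟩, inferInstance, hR₁⟩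
  haveI := hP
  have h𝔭P : Ideal.span {chartIncl (K := K) x y x} < P := by
    refine lt_of_le_of_ne (le_sup_right.trans hIP) fun heq => hWx ?_
    rw [heq]; exact le_sup_left.trans hIP
  exact (eq_of_span_lt_of_le hdim hx0 h𝔭 h𝔭P hPQ).ge

/-- **Only finitely many two-dimensional regular first quadratic transforms carry a colon transform `(J S' : x^m)` of
order `≥ b`** (`J` of exact order `r`, `m ≤ r < m + b`; `𝔪 = (x, y)` a good pair of parameters) — the marked tree's
`finite_setOf_isQuadraticTransform_ctrlTransform_le` with decoupled exponents. [cite: ZariskiSamuel1960, Appendix 5] -/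
theorem finite_setOf_isQuadraticTransform_ctrlTransform_le₂ (hdim : ringKrullDim S = 2)
    (hm : maximalIdeal S = Ideal.span {x, y}) (hx0 : x ≠ 0) (hy0 : y ≠ 0)
    (hpq : ∀ t, x ∣ y * t → x ∣ t) (hqp : ∀ t, y ∣ x * t → y ∣ t)
    {J : Ideal S} {r : ℕ} (hJ : J ≤ maximalIdeal S ^ r) (hJr : ¬ J ≤ maximalIdeal S ^ (r + 1))
    (hbr : m ≤ r) (hr2 : r < m + b) :
    {S' : Subring K | ∃ (_ : IsRegularLocalRing S'), IsQuadraticTransform S S' ∧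
      ringKrullDim S' = 2 ∧ ctrlTransform m S J S' ≤ maximalIdeal S' ^ b}.Finite := by
  classical
  have hm' : maximalIdeal S = Ideal.span {y, x} := by rw [hm, Set.pair_comm]
  let fx : Ideal (chartAdjoin (K := K) x y) → Subring K := fun Q =>
    if h : Q.IsPrime then (@LocalSubring.ofPrime K _ (chartAdjoin (K := K) x y) Q h).toSubring else ⊥
  let fy : Ideal (chartAdjoin (K := K) y x) → Subring K := fun Q =>
    if h : Q.IsPrime then (@LocalSubring.ofPrime K _ (chartAdjoin (K := K) y x) Q h).toSubring else ⊥
  haveI : IsNoetherianRing (chartAdjoin (K := K) x y) := isNoetherianRing_adjoin_toSubring S _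
  haveI : IsNoetherianRing (chartAdjoin (K := K) y x) := isNoetherianRing_adjoin_toSubring S _
  have hfinx := (Ideal.finite_minimalPrimes_of_isNoetherianRing _
    (weakTransformChart (K := K) x y J r ⊔ Ideal.span {chartIncl x y x})).image fx
  have hfiny := (Ideal.finite_minimalPrimes_of_isNoetherianRing _
    (weakTransformChart (K := K) y x J r ⊔ Ideal.span {chartIncl y x y})).image fy
  refine (hfinx.union hfiny).subset ?_
  rintro S' ⟨hreg, h₁, hd', hsing⟩
  rcases h₁.blowupRing_le_or hm with hX | hY
  · left
    have hle : chartAdjoin (K := K) x y ≤ S' := (blowupRing_eq_adjoin (K := K) hm).symm.le.trans hX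
    obtain ⟨Q, hQmin, hQp, hR₁⟩ :=
      exists_minimalPrime_of_ctrlTransform_le₂ hdim hm hx0 hpq hJ hJr hbr hr2 h₁ hd' hle hsing
    refine ⟨Q, hQmin, ?_⟩
    simp only [fx, dif_pos hQp]
    exact hR₁.symm
  · right
    have hle : chartAdjoin (K := K) y x ≤ S' := (blowupRing_eq_adjoin (K := K) hm').symm.le.trans hY
    obtain ⟨Q, hQmin, hQp, hR₁⟩ :=
      exists_minimalPrime_of_ctrlTransform_le₂ hdim hm' hy0 hqp hJ hJr hbr hr2 h₁ hd' hle hsing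
    refine ⟨Q, hQmin, ?_⟩
    simp only [fy, dif_pos hQp]
    exact hR₁.symm

end Chart

/-! ## Finite branching of the loose tree -/

/-- **A node of the loose tree has finitely many singular children**: out of a non-isolated node there is no step;
an isolated node `(S, J)` (`J` of exact order `r`, loose exponent `m = b·⌊r/b⌋`, `m ≤ r < m + b`) has finitely many
two-dimensional first quadratic transforms at which the loose transform keeps order `≥ b`. [cite: ZariskiSamuel1960, Appendix 5] -/
theorem finite_setOf_looseStep_isSingularNode (b : ℕ) (n₀ : MarkedNode K) :
    {n : MarkedNode K | LooseStep b n₀ n ∧ IsSingularNode b n}.Finite := by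
  classical
  by_cases ht : IsIsolatedNode b n₀
  swap
  · refine Set.finite_empty.subset ?_
    rintro n ⟨hs, -⟩
    exact ht hs.isIsolatedNode
  obtain ⟨S, J⟩ := n₀
  obtain ⟨⟨hreg, hdim, -, hJb⟩, -, -⟩ := id ht
  haveI := hreg
  have hb : 0 < b := ht.b_pos
  have hJ0 : J ≠ ⊥ := ht.ne_bot
  -- the exact order `r` of `J` and the loose exponent `m`: `m ≤ r < m + b`
  have hJ : J ≤ maximalIdeal S ^ exactOrder S J := le_pow_exactOrder J
  have hJr : ¬ J ≤ maximalIdeal S ^ (exactOrder S J + 1) := not_le_pow_exactOrder_succ hJ0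
  have hbr : looseExponent b S J ≤ exactOrder S J := looseExponent_le b J
  have hr2 : exactOrder S J < looseExponent b S J + b := exactOrder_lt_looseExponent_add hb J
  -- a good regular system of parameters
  obtain ⟨u, v, huv, hup, hvp, huv', hvu'⟩ := exists_maximalIdeal_eq_span_pair hdim
  have hu0 : u ≠ 0 := hup.ne_zero
  have hv0 : v ≠ 0 := hvp.ne_zero
  have hpq : ∀ t, u ∣ v * t → u ∣ t := fun t ht => (hup.dvd_or_dvd ht).resolve_left huv'
  have hqp : ∀ t, v ∣ u * t → v ∣ t := fun t ht => (hvp.dvd_or_dvd ht).resolve_left hvu'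
  have hfin := finite_setOf_isQuadraticTransform_ctrlTransform_le₂ (K := K) hdim huv hu0 hv0 hpq hqp
    hJ hJr hbr hr2
  refine (hfin.image (looseChild b S J)).subset ?_
  rintro n ⟨hstep, hsing⟩
  obtain ⟨S', J'⟩ := n
  obtain ⟨-, _, h₁, hd', hJ'⟩ := hstep
  obtain ⟨hreg', -, -, hle'⟩ := hsing
  dsimp only at h₁ hd' hJ' hreg' hle'
  subst hJ'
  exact ⟨S', ⟨hreg', h₁, hd', hle'⟩, rfl⟩

end Summit.ResolutionOfSingularities.ResolutionOfSingularities.Theorems.CampaignW46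

end
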